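/-
COR-CM (cell pub-hodgecm2) — TEAM hComp (coordinator ruling 2026-08-21T18:44:30Z), seat hcomp-level gen 38, proposed table row U2e (HCOMP-TABLE;
asked HOME/INBOX l.7227): SPLITTING LINE BRIDGE — the W-side complement of the diagonal frame (m6′) (`HComp/HermSpaceDiagonalFrame.lean`, row U2d):
`CompatibleSplitting` of the ω file's LINE splitting datum over `(diagonal V.diagEntries, J_W)` from the CM lane's `cmSplittingDatum` at
`dW := (T_W 0 0 : L)`.  Re-cut in the tree's currency (theorems only; the [GelbartRogawski1991, Prop. 3.1.1] input is taken PER DATUM as the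
tree-typed hypothesis `hGR`, exactly as `UnitaryDualPairThetaKernelCM.cmPairSplitting (hGR : …)` does) from s2crux-idea-2 gen 9's seat probe
`HGR-LineBridge.lean` md5 32617dc4c2ec (HOME/INBOX l.7213).  Count-neutral (no BINDER-OWNERS row, no record, nothing cited as a new fact);
HC_CM is NOT proved and nothing here bears on it.
-/
import Literature.NumberTheory.GelbartRogawski1991.UnitaryDualPairThetaKernelCM
import Summits.HodgeConjecture.CorCM.B01.Transposition.HComp.HermSpaceDiagonalFrame
import HarnessLib

/-!
# COR-CM / hComp — the splitting line bridge: `CompatibleSplitting` of the line datum `(diag dV, J_W)` from the CM lane's datum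

Let `L` be a CM field, `L⁺ = maximalRealSubfield L`, `c̄ = IsCMField.complexConj L`.  The ω-side of [Liu2021] Thm. 4.18 (Def. 4.11: the
Weil representation of the unitary dual pair `U(V) × U(W)`, `W = ⟨a⟩` a hermitian LINE, `a ∈ (L⁺)ˣ`) is typed in the tree over the
Gelbart–Rogawski splitting datum
`UnitaryDualPair.splittingDatum L⁺ L c̄ N 1 e J_V J_W hcδ hδ hd hV hW hVd hWd hJV hJW`
(`Literature/NumberTheory/GelbartRogawski1991/UnitaryDualPairSplittingDatum.lean`; `J_V = T_V ⊗ L`, `J_W = T_W ⊗ L` with `T_V`, `T_W`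
SYMMETRIC of unit determinant over `L⁺`), read at the CM lane's constants `δ := imagUnit L`, `T_V := realDiagonal L dV hdV`,
`J_V := diagonal dV` (`UnitaryDualPairThetaKernelCM.lean` §1–§2) and — for the hermitian 3-space `V : HermSpace3 L ι₁` — at
`dV := V.diagEntries` through the diagonal frame of row U2d (`HermSpace3.diagEntries`, `complexConj_diagEntries`, `diagEntries_ne_zero`).
To APPLY an END display carrying the splitting family `s` with `hs` (compatible) and `hsc` (continuous) over that datum one exhibits, by
`UnitaryDualPair.splittingOf` ∕ `splittingOf_isCompatible` ∕ `continuous_pairSplitting_splittingOf` (`UnitaryDualPairThetaKernel.lean`),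
the Prop `(that datum).CompatibleSplitting` — [GelbartRogawski1991, Prop. 3.1.1] for `G₁ = U(J_V ⊗ J_W)`.

The CM lane states [GelbartRogawski1991, Prop. 3.1.1] for DIAGONAL W-data: `(cmSplittingDatum L e dV hdV hdV0 dW hdW hdW0).CompatibleSplitting`
with `dW : Fin M → L` conjugation-fixed and non-zero (the hypothesis `hGR` of `cmPairSplitting`, `cmThetaKernelDatum`, …; derived in
`GRConstruction.gru_shape_of` ∕ `gru_body_of` from the per-place package and the archimedean half, `CompatibleSplittingCMDoubling.lean`).
A line's `T_W : Matrix (Fin 1) (Fin 1) L⁺` IS `realDiagonal L dW _` for `dW 0 := (T_W 0 0 : L)`, and `J_W = T_W ⊗ L` IS `diagonal dW`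
— but only propositionally, and `T_W`, `J_W` occur in the TYPE of the splitting datum.  This file is the typed glue:

* `HComp.compatibleSplitting_splittingDatum_congr` — `CompatibleSplitting` transported along EQUAL W-side Gram data `T_W = T_W'`,
  `J_W = J_W'` (all other data fixed; the proof arguments ride along by proof irrelevance);
* `HComp.complexConj_lineEntry`, `HComp.lineEntry_ne_zero`, `HComp.realDiagonal_lineEntry`, `HComp.diagonal_lineEntry` — the `1 × 1`
  bookkeeping: the entry of `T_W` read in `L` is conjugation-fixed and (unit determinant) non-zero, `realDiagonal L (T_W · ·) _ = T_W`,
  `diagonal (T_W · ·) = J_W`;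
* `HComp.compatibleSplitting_line` — for every CM field `L`, `e : Fin N × Fin 1 ≃ Fin n`, diagonal V-data `(dV, hdV, hdV0)`, every
  `T_W` (symmetric, unit determinant) and `J_W = T_W ⊗ L`: `hGR` at `dW := (T_W · ·)` GIVES the `CompatibleSplitting` of the line datum over
  `(diagonal dV, J_W)`; `HComp.compatibleSplitting_line_of_forall` — the same from the ∀-form (the conclusion shape of
  `GRConstruction.gru_shape_of`, taken INLINE as a hypothesis, discharged by one application of that theorem or of Stage-1's closer);
* `HermSpace3.compatibleSplitting_line V`, `HermSpace3.compatibleSplitting_line_of_forall V` — the instance `N = 3`, `e = finProdFinEquiv`,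
  `dV := V.diagEntries` for `V : HermSpace3 L ι₁`: at `T_W := [Liu2021, Def. 4.11]'s `!![a]`, `J_W := T_W ⊗ L` the conclusion is literally
  the `CompatibleSplitting` that `splittingOf` consumes for the line `⟨a⟩`.

Everything is proved; no definition, no record, one hypothesis (`hGR` ∕ its ∀-form) of a tree-typed Prop.  T5: n/a (one Prop binder, no
joint binder set).  References: S. Gelbart, J. Rogawski, Invent. Math. 105 (1991) §3.1 Prop. 3.1.1 p. 455 [GelbartRogawski1991]; Y. Liu,
Camb. J. Math. 9 (2021) = arXiv:2102.11518, Def. 4.11 and App. D §D.1 Steps 1–2 [Liu2021].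
-/

set_option autoImplicit false

open NumberField
open Literature.NumberTheory.GelbartRogawski1991
open Literature.NumberTheory.GelbartRogawski1991.UnitaryDualPair

namespace Summit.HodgeConjecture.CorCM

namespace HComp

/-! ## §1  Transport of `CompatibleSplitting` along equal W-side Gram data -/

section Congr

set_option maxHeartbeats 2000000 in
/-- **Transport of `CompatibleSplitting` along equal W-side Gram data.**  The carrier types of the splitting datum
`splittingDatum F E c N M e J_V J_W …` depend on `(T_W, J_W)`; along `T_W = T_W'`, `J_W = J_W'` (the V-side and all scalar data
fixed) the Prop `CompatibleSplitting` is transported, the proof arguments `hW ∕ hWd ∕ hJW` riding along by proof irrelevance.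
(All hypotheses are theorem binders — no `variable` line carries a Prop.) [cite: GelbartRogawski1991, §3.1 Prop. 3.1.1 p. 455 L1–3] -/
theorem compatibleSplitting_splittingDatum_congr (F E : Type) [Field F] [NumberField F] [Field E] [NumberField E] [Algebra F E]
    (c : E ≃ₐ[F] E) (N M : ℕ) {n : ℕ} (e : Fin N × Fin M ≃ Fin n) (JV : Matrix (Fin N) (Fin N) E)
    [Algebra.IsQuadraticExtension F E] {δ : E} (hcδ : c δ = -δ) (hδ : δ ≠ 0) {d : F} (hd : δ * δ = algebraMap F E d)
    {TV : Matrix (Fin N) (Fin N) F} (hV : TV.IsSymm) (hVd : IsUnit TV.det) (hJV : JV = TV.map (algebraMap F E))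
    {TW TW' : Matrix (Fin M) (Fin M) F} {JW JW' : Matrix (Fin M) (Fin M) E}
    (hT : TW = TW') (hJ : JW = JW') (hW : TW.IsSymm) (hW' : TW'.IsSymm) (hWd : IsUnit TW.det) (hWd' : IsUnit TW'.det)
    (hJW : JW = TW.map (algebraMap F E)) (hJW' : JW' = TW'.map (algebraMap F E)) :
    (splittingDatum F E c N M e JV JW hcδ hδ hd hV hW hVd hWd hJV hJW).CompatibleSplitting →
      (splittingDatum F E c N M e JV JW' hcδ hδ hd hV hW' hVd hWd' hJV hJW').CompatibleSplitting := by
  subst hT hJ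
  intro h
  exact h

end Congr

/-! ## §2  A hermitian line: `T_W ∈ M₁(L⁺)` as `realDiagonal`, `J_W = T_W ⊗ L` as `diagonal` -/

section Line

variable (L : Type) [Field L] [NumberField L] [IsCMField L]

/-- the entry of `T_W ∈ M₁(L⁺)`, read in `L`, is fixed by complex conjugation. [folklore] -/
theorem complexConj_lineEntry (TW : Matrix (Fin 1) (Fin 1) ↥(maximalRealSubfield L)) (i : Fin 1) :
    IsCMField.complexConj L ((TW i i : ↥(maximalRealSubfield L)) : L) = ((TW i i : ↥(maximalRealSubfield L)) : L) :=
  (IsCMField.complexConj_eq_self_iff (K := L) _).2 (TW i i).2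

omit [NumberField L] [IsCMField L] in
/-- the entry of `T_W ∈ M₁(L⁺)` is non-zero when `det T_W` is a unit (`det` of a `1 × 1` matrix is its entry). [folklore] -/
theorem lineEntry_ne_zero (TW : Matrix (Fin 1) (Fin 1) ↥(maximalRealSubfield L)) (hWd : IsUnit TW.det) (i : Fin 1) :
    ((TW i i : ↥(maximalRealSubfield L)) : L) ≠ 0 := by
  intro h0
  obtain rfl : i = 0 := Subsingleton.elim _ _
  have h00 : TW 0 0 = 0 := by exact_mod_cast h0
  have hdet : TW.det = 0 := by rw [Matrix.det_fin_one, h00]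
  exact not_isUnit_zero (hdet ▸ hWd)

/-- `realDiagonal L (T_W · ·) _ = T_W`: a `1 × 1` matrix over `L⁺` is the real diagonal matrix of its entry. [folklore] -/
theorem realDiagonal_lineEntry (TW : Matrix (Fin 1) (Fin 1) ↥(maximalRealSubfield L)) :
    realDiagonal L (fun i => ((TW i i : ↥(maximalRealSubfield L)) : L)) (complexConj_lineEntry L TW) = TW := by
  ext i j
  obtain rfl : i = j := Subsingleton.elim _ _
  simp [realDiagonal, Matrix.diagonal]

omit [NumberField L] [IsCMField L] in
/-- `diagonal (T_W · ·) = J_W` for `J_W = T_W ⊗_{L⁺} L`: a `1 × 1` matrix is the diagonal matrix of its entry. [folklore] -/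
theorem diagonal_lineEntry (TW : Matrix (Fin 1) (Fin 1) ↥(maximalRealSubfield L)) {JW : Matrix (Fin 1) (Fin 1) L}
    (hJW : JW = TW.map (algebraMap (↥(maximalRealSubfield L)) L)) :
    (Matrix.diagonal fun i => ((TW i i : ↥(maximalRealSubfield L)) : L)) = JW := by
  subst hJW
  ext i j
  obtain rfl : i = j := Subsingleton.elim _ _
  rw [Matrix.diagonal_apply_eq, Matrix.map_apply]
  rfl

set_option maxHeartbeats 2000000 in
/-- **The splitting line bridge.**  For every CM field `L`, `e : Fin N × Fin 1 ≃ Fin n`, conjugation-fixed non-zero diagonal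
V-data `dV`, every `T_W ∈ M₁(L⁺)` symmetric of unit determinant and `J_W = T_W ⊗ L`: [GelbartRogawski1991, Prop. 3.1.1] for the
CM lane's datum at `dW := (T_W · ·)` (`hGR`, the hypothesis of `UnitaryDualPairThetaKernelCM.cmPairSplitting`) gives the
`CompatibleSplitting` of the line splitting datum over `(diagonal dV, J_W)` at the CM lane's constants — the Prop that
`UnitaryDualPair.splittingOf` consumes. [cite: GelbartRogawski1991, §3.1 Prop. 3.1.1 p. 455 L1–3] -/
theorem compatibleSplitting_line {N n : ℕ} (e : Fin N × Fin 1 ≃ Fin n)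
    (dV : Fin N → L) (hdV : ∀ i, IsCMField.complexConj L (dV i) = dV i) (hdV0 : ∀ i, dV i ≠ 0)
    (TW : Matrix (Fin 1) (Fin 1) ↥(maximalRealSubfield L)) (hW : TW.IsSymm) (hWd : IsUnit TW.det)
    (JW : Matrix (Fin 1) (Fin 1) L) (hJW : JW = TW.map (algebraMap (↥(maximalRealSubfield L)) L))
    (hGR : (cmSplittingDatum L e dV hdV hdV0 (fun i => ((TW i i : ↥(maximalRealSubfield L)) : L))
      (complexConj_lineEntry L TW) (lineEntry_ne_zero L TW hWd)).CompatibleSplitting) :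
    (splittingDatum (↥(maximalRealSubfield L)) L (IsCMField.complexConj L) N 1 e (Matrix.diagonal dV) JW
        (complexConj_imagUnit L) (imagUnit_ne_zero L) (imagUnit_mul_self L) (realDiagonal_isSymm L dV hdV) hW
        (isUnit_det_realDiagonal L dV hdV hdV0) hWd (realDiagonal_map L dV hdV).symm hJW).CompatibleSplitting :=
  compatibleSplitting_splittingDatum_congr (↥(maximalRealSubfield L)) L (IsCMField.complexConj L) N 1 e
    (Matrix.diagonal dV) (complexConj_imagUnit L) (imagUnit_ne_zero L) (imagUnit_mul_self L) (realDiagonal_isSymm L dV hdV)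
    (isUnit_det_realDiagonal L dV hdV hdV0) (realDiagonal_map L dV hdV).symm (realDiagonal_lineEntry L TW)
    (diagonal_lineEntry L TW hJW) (realDiagonal_isSymm L _ (complexConj_lineEntry L TW)) hW
    (isUnit_det_realDiagonal L _ (complexConj_lineEntry L TW) (lineEntry_ne_zero L TW hWd)) hWd
    (realDiagonal_map L _ (complexConj_lineEntry L TW)).symm hJW hGR

set_option maxHeartbeats 2000000 in
/-- **The splitting line bridge from the ∀-form.**  The same with [GelbartRogawski1991, Prop. 3.1.1] for the CM lane's datum taken
in its ∀-shape over all CM fields and all diagonal data (verbatim the conclusion of `GRConstruction.gru_shape_of`, so one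
application of that theorem — or of its hypothesis-free closer — discharges `hGRU`). [cite: GelbartRogawski1991, §3.1 Prop. 3.1.1 p. 455 L1–3] -/
theorem compatibleSplitting_line_of_forall
    (hGRU : ∀ (L : Type) [Field L] [NumberField L] [IsCMField L] {N M n : ℕ} (e : Fin N × Fin M ≃ Fin n)
      (dV : Fin N → L) (hdV : ∀ i, IsCMField.complexConj L (dV i) = dV i) (hdV0 : ∀ i, dV i ≠ 0)
      (dW : Fin M → L) (hdW : ∀ i, IsCMField.complexConj L (dW i) = dW i) (hdW0 : ∀ i, dW i ≠ 0),
      (cmSplittingDatum L e dV hdV hdV0 dW hdW hdW0).CompatibleSplitting)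
    {N n : ℕ} (e : Fin N × Fin 1 ≃ Fin n)
    (dV : Fin N → L) (hdV : ∀ i, IsCMField.complexConj L (dV i) = dV i) (hdV0 : ∀ i, dV i ≠ 0)
    (TW : Matrix (Fin 1) (Fin 1) ↥(maximalRealSubfield L)) (hW : TW.IsSymm) (hWd : IsUnit TW.det)
    (JW : Matrix (Fin 1) (Fin 1) L) (hJW : JW = TW.map (algebraMap (↥(maximalRealSubfield L)) L)) :
    (splittingDatum (↥(maximalRealSubfield L)) L (IsCMField.complexConj L) N 1 e (Matrix.diagonal dV) JW
        (complexConj_imagUnit L) (imagUnit_ne_zero L) (imagUnit_mul_self L) (realDiagonal_isSymm L dV hdV) hW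
        (isUnit_det_realDiagonal L dV hdV hdV0) hWd (realDiagonal_map L dV hdV).symm hJW).CompatibleSplitting :=
  compatibleSplitting_line L e dV hdV hdV0 TW hW hWd JW hJW
    (hGRU L e dV hdV hdV0 (fun i => ((TW i i : ↥(maximalRealSubfield L)) : L)) (complexConj_lineEntry L TW)
      (lineEntry_ne_zero L TW hWd))

end Line

end HComp

/-! ## §3  The instance of the hermitian 3-space through its diagonal frame (row U2d) -/

namespace HermSpace3

variable {L : CMField} {ι₁ : L →+* ℂ} (V : HermSpace3 L ι₁)

set_option maxHeartbeats 2000000 in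
/-- **The splitting line bridge at `V : HermSpace3 L ι₁`** (`N = 3`, `e = finProdFinEquiv`, `dV := V.diagEntries` through the diagonal
frame): for every W-side line datum `(T_W, J_W = T_W ⊗ L)`, [GelbartRogawski1991, Prop. 3.1.1] for the CM lane's datum
`cmSplittingDatum L finProdFinEquiv V.diagEntries … (T_W · ·) …` gives the `CompatibleSplitting` of the line splitting datum over
`(diagonal V.diagEntries, J_W)` — at `T_W := !![a]`, `J_W := T_W ⊗ L` ([Liu2021, Def. 4.11], `W = ⟨a⟩`) literally the Prop that
`UnitaryDualPair.splittingOf` ∕ `splittingOf_isCompatible` ∕ `continuous_pairSplitting_splittingOf` turn into the END display's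
`s ∕ hs ∕ hsc` at the line `⟨a⟩`. [cite: GelbartRogawski1991, §3.1 Prop. 3.1.1 p. 455 L1–3] -/
theorem compatibleSplitting_line
    (TW : Matrix (Fin 1) (Fin 1) ↥(maximalRealSubfield L)) (hW : TW.IsSymm) (hWd : IsUnit TW.det)
    (JW : Matrix (Fin 1) (Fin 1) L) (hJW : JW = TW.map (algebraMap (↥(maximalRealSubfield L)) L))
    (hGR : (cmSplittingDatum L finProdFinEquiv V.diagEntries V.complexConj_diagEntries V.diagEntries_ne_zero
      (fun i => ((TW i i : ↥(maximalRealSubfield L)) : L)) (HComp.complexConj_lineEntry L TW)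
      (HComp.lineEntry_ne_zero L TW hWd)).CompatibleSplitting) :
    (splittingDatum (↥(maximalRealSubfield L)) L (IsCMField.complexConj L) 3 1 finProdFinEquiv (Matrix.diagonal V.diagEntries) JW
        (complexConj_imagUnit L) (imagUnit_ne_zero L) (imagUnit_mul_self L)
        (realDiagonal_isSymm L V.diagEntries V.complexConj_diagEntries) hW
        (isUnit_det_realDiagonal L V.diagEntries V.complexConj_diagEntries V.diagEntries_ne_zero) hWd
        (realDiagonal_map L V.diagEntries V.complexConj_diagEntries).symm hJW).CompatibleSplitting :=
  HComp.compatibleSplitting_line L finProdFinEquiv V.diagEntries V.complexConj_diagEntries V.diagEntries_ne_zero TW hW hWd JW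
    hJW hGR

set_option maxHeartbeats 2000000 in
/-- **The splitting line bridge at `V : HermSpace3 L ι₁` from the ∀-form** of [GelbartRogawski1991, Prop. 3.1.1] for the CM lane's
datum (the conclusion shape of `GRConstruction.gru_shape_of`, taken inline). [cite: GelbartRogawski1991, §3.1 Prop. 3.1.1 p. 455 L1–3] -/
theorem compatibleSplitting_line_of_forall
    (hGRU : ∀ (L : Type) [Field L] [NumberField L] [IsCMField L] {N M n : ℕ} (e : Fin N × Fin M ≃ Fin n)
      (dV : Fin N → L) (hdV : ∀ i, IsCMField.complexConj L (dV i) = dV i) (hdV0 : ∀ i, dV i ≠ 0)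
      (dW : Fin M → L) (hdW : ∀ i, IsCMField.complexConj L (dW i) = dW i) (hdW0 : ∀ i, dW i ≠ 0),
      (cmSplittingDatum L e dV hdV hdV0 dW hdW hdW0).CompatibleSplitting)
    (TW : Matrix (Fin 1) (Fin 1) ↥(maximalRealSubfield L)) (hW : TW.IsSymm) (hWd : IsUnit TW.det)
    (JW : Matrix (Fin 1) (Fin 1) L) (hJW : JW = TW.map (algebraMap (↥(maximalRealSubfield L)) L)) :
    (splittingDatum (↥(maximalRealSubfield L)) L (IsCMField.complexConj L) 3 1 finProdFinEquiv (Matrix.diagonal V.diagEntries) JW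
        (complexConj_imagUnit L) (imagUnit_ne_zero L) (imagUnit_mul_self L)
        (realDiagonal_isSymm L V.diagEntries V.complexConj_diagEntries) hW
        (isUnit_det_realDiagonal L V.diagEntries V.complexConj_diagEntries V.diagEntries_ne_zero) hWd
        (realDiagonal_map L V.diagEntries V.complexConj_diagEntries).symm hJW).CompatibleSplitting :=
  HComp.compatibleSplitting_line_of_forall L hGRU finProdFinEquiv V.diagEntries V.complexConj_diagEntries V.diagEntries_ne_zero
    TW hW hWd JW hJW

end HermSpace3

end Summit.HodgeConjecture.CorCM
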